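import Summits.NavierStokesRegularity.NavierStokesRegularity.Theses.LandauTail
import Literature.Analysis.FluidPDE.HomogeneousEuler

/-!
# Strategist sketch — crux `LandauTail.LandauTailBlowup` (stmt-NavierStokesRegularity-1944)

Typed pieces of the FROZEN-PROFILE / PUNCTURED-LERAY-RIGIDITY cut and their glue.
-/

noncomputable section

open Set Filter Topology MeasureTheory

namespace Summit.NavierStokesRegularity.NavierStokesRegularity.Cruxes.LandauTailBlowup.Strategist

open Literature.Analysis.FluidPDE
open Summit.NavierStokesRegularity.NavierStokesRegularity.Theses.LandauTail

set_option linter.dupNamespace false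

local notation "ℝ³" => EuclideanSpace ℝ (Fin 3)

/-- S1 (∃, local class, ν = 1, singular point (0,0)): FROZEN PUNCTURED-LERAY PROFILE with small
envelope. For every ε > 0 there is a classical NS solution on ℝ³ × (−1,0) with Tsai local energy bounds
in B₁ whose parabolic rescaling converges pointwise off 0 to a profile `V` which is smooth off 0,
nonzero, normalised by the junk value `V 0 = 0`, solves Leray's backward profile system with rate
a = 1/2 OFF THE ORIGIN (punctured profile, pressure `Q`), and has spatial envelope `‖y‖‖V y‖ ≤ ε`. -/
def FrozenProfileLocal : Prop :=
  ∀ ε : ℝ, 0 < ε → ∃ (u : ℝ → ℝ³ → ℝ³) (p : ℝ → ℝ³ → ℝ) (V : ℝ³ → ℝ³) (Q : ℝ³ → ℝ),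
    (ContDiffOn ℝ (⊤ : ℕ∞) V {0}ᶜ ∧ ContDiffOn ℝ (⊤ : ℕ∞) Q {0}ᶜ ∧ V 0 = 0 ∧
      (∀ y : ℝ³, y ≠ 0 → -((1 : ℝ) • Laplacian.laplacian V y) + (1 / 2 : ℝ) • V y +
        (1 / 2 : ℝ) • fderiv ℝ V y y + convect V V y + gradient Q y = 0) ∧
      (∀ y : ℝ³, y ≠ 0 → VectorCalculus.divergence V y = 0) ∧ (∃ y : ℝ³, V y ≠ 0) ∧
      (∀ y : ℝ³, y ≠ 0 → ‖y‖ * ‖V y‖ ≤ ε)) ∧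
    IsClassicalNSSolutionOn (Set.Ioo (-1) 0) 1 0 u p ∧
    (∃ C : NNReal, ∀ t ∈ Set.Ioo (-1 : ℝ) 0, ∫⁻ x in Metric.ball (0 : ℝ³) 1, ‖u t x‖ₑ ^ 2 ≤ C) ∧
    (∫⁻ t in Set.Ioo (-1 : ℝ) 0, ∫⁻ x in Metric.ball (0 : ℝ³) 1,
        ENNReal.ofReal (frobeniusNormSq (fderiv ℝ (u t) x)) < ⊤) ∧
    (∀ y : ℝ³, y ≠ 0 → Filter.Tendsto (fun t : ℝ => Real.sqrt (0 - t) • u t (Real.sqrt (0 - t) • y))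
      (nhdsWithin 0 (Set.Iio 0)) (nhds (V y)))

/-- S2 (∀, rigidity, small envelope): PUNCTURED TSAI. There is ε₀ > 0 such that every punctured
Leray profile (ν = 1, a = 1/2; smooth off 0; profile system and incompressibility OFF THE ORIGIN) with
spatial envelope `‖y‖‖V y‖ ≤ ε₀` on ℝ³ ∖ {0} is homogeneous of degree −1 off the origin (hence, by the
profile equation, a steady Navier–Stokes flow off 0, i.e. a Landau solution by Šverák). -/
def PuncturedLerayRigiditySmall : Prop :=
  ∃ ε : ℝ, 0 < ε ∧ ∀ (V : ℝ³ → ℝ³) (Q : ℝ³ → ℝ),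
    ContDiffOn ℝ (⊤ : ℕ∞) V {0}ᶜ → ContDiffOn ℝ (⊤ : ℕ∞) Q {0}ᶜ →
    (∀ y : ℝ³, y ≠ 0 → -((1 : ℝ) • Laplacian.laplacian V y) + (1 / 2 : ℝ) • V y +
        (1 / 2 : ℝ) • fderiv ℝ V y y + convect V V y + gradient Q y = 0) →
    (∀ y : ℝ³, y ≠ 0 → VectorCalculus.divergence V y = 0) →
    (∀ y : ℝ³, y ≠ 0 → ‖y‖ * ‖V y‖ ≤ ε) →
    ∀ c : ℝ, 0 < c → ∀ y : ℝ³, y ≠ 0 → V (c • y) = c⁻¹ • V y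

/-- S2⁺ (∀, rigidity, ANY envelope): the Liouville-grade form (Tsai 1998 Thm 1/2 with one puncture). -/
def PuncturedLerayRigidity : Prop :=
  ∀ (C : ℝ) (V : ℝ³ → ℝ³) (Q : ℝ³ → ℝ),
    ContDiffOn ℝ (⊤ : ℕ∞) V {0}ᶜ → ContDiffOn ℝ (⊤ : ℕ∞) Q {0}ᶜ →
    (∀ y : ℝ³, y ≠ 0 → -((1 : ℝ) • Laplacian.laplacian V y) + (1 / 2 : ℝ) • V y +
        (1 / 2 : ℝ) • fderiv ℝ V y y + convect V V y + gradient Q y = 0) →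
    (∀ y : ℝ³, y ≠ 0 → VectorCalculus.divergence V y = 0) →
    (∀ y : ℝ³, y ≠ 0 → ‖y‖ * ‖V y‖ ≤ C) →
    ∀ c : ℝ, 0 < c → ∀ y : ℝ³, y ≠ 0 → V (c • y) = c⁻¹ • V y

/-- The large form implies the small form (take ε₀ = 1). -/
theorem puncturedLerayRigiditySmall_of_large (h : PuncturedLerayRigidity) :
    PuncturedLerayRigiditySmall :=
  ⟨1, one_pos, fun V Q hV hQ heq hdiv henv => h 1 V Q hV hQ heq hdiv henv⟩

/-- Euler's relation for a field homogeneous of degree −1 off the origin. -/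
theorem fderiv_apply_self_of_inv_smul {V : ℝ³ → ℝ³} {y : ℝ³} (hy : y ≠ 0)
    (hhom : ∀ c : ℝ, 0 < c → V (c • y) = c⁻¹ • V y) (hd : DifferentiableAt ℝ V y) :
    fderiv ℝ V y y = (-1 : ℝ) • V y := by
  refine fderiv_apply_self_of_smul_eq_rpow_smul (m := -1) (fun c hc => ?_) hd
  rw [Real.rpow_neg_one]
  exact hhom c hc

/-- CALIBRATION / inner glue: S1 ∧ S2 ⊢ `LandauTailLocal` (the route's rank-2 crux, stmt-1946). -/
theorem landauTailLocal_of_frozen_rigidity (h1 : FrozenProfileLocal)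
    (h2 : PuncturedLerayRigiditySmall) : LandauTailLocal := by
  obtain ⟨ε, hε, hrig⟩ := h2
  obtain ⟨u, p, V, Q, ⟨hV, hQ, hV0, heq, hdiv, hne, henv⟩, hcl, hE, hD, hconv⟩ := h1 ε hε
  have hhom : ∀ c : ℝ, 0 < c → ∀ y : ℝ³, y ≠ 0 → V (c • y) = c⁻¹ • V y :=
    hrig V Q hV hQ heq hdiv henv
  refine ⟨u, p, V, Q, ⟨hV, hQ, ?_, hdiv, ?_, hne⟩, hcl, hE, hD, hconv⟩
  · intro x hx
    have hdiff : DifferentiableAt ℝ V x :=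
      (hV.differentiableOn (by simp)).differentiableAt (isOpen_compl_singleton.mem_nhds hx)
    have hEul : fderiv ℝ V x x = (-1 : ℝ) • V x :=
      fderiv_apply_self_of_inv_smul hx (fun c hc => hhom c hc x hx) hdiff
    have h0 := heq x hx
    rw [hEul] at h0
    have key : (1 / 2 : ℝ) • V x + (1 / 2 : ℝ) • ((-1 : ℝ) • V x) = 0 := by
      rw [smul_smul, ← add_smul]; norm_num
    rw [one_smul] at h0
    calc convect V V x + gradient Q x
        = (-(Laplacian.laplacian V x) + (1 / 2 : ℝ) • V x + (1 / 2 : ℝ) • ((-1 : ℝ) • V x) +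
            convect V V x + gradient Q x) + Laplacian.laplacian V x -
            ((1 / 2 : ℝ) • V x + (1 / 2 : ℝ) • ((-1 : ℝ) • V x)) := by abel
      _ = (1 : ℝ) • Laplacian.laplacian V x := by rw [h0, key]; simp
  · intro c hc x
    by_cases hx : x = 0
    · subst hx; simp [hV0]
    · exact hhom c hc x hx

/-- OUTER GLUE (the line's composition and the split's assembly):
S1 → S2 → LandauTailTransfer → LandauTailBlowup. -/
theorem landauTailBlowup_of_frozen_rigidity_transfer (h1 : FrozenProfileLocal)
    (h2 : PuncturedLerayRigiditySmall) (h3 : LandauTailTransfer) : LandauTailBlowup :=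
  h3 (landauTailLocal_of_frozen_rigidity h1 h2)

/-- The route's own layer-1 cut (birth line): Local → Transfer → X (modus ponens across the
definitional seam `LandauTailTransfer ≝ Local-body → X-body`). -/
theorem landauTailBlowup_of_subs (h1 : LandauTailLocal) (h2 : LandauTailTransfer) :
    LandauTailBlowup :=
  h2 h1


/-- NEGATION-SIDE TARGET (the positive theorem that kills line frozen-rigidity AND `LandauTailLocal` at once):
"asymptotic Tsai Theorem 2 with a puncture" — no local-energy-class classical solution on ℝ³ × (−1,0) freezes
(pointwise off 0, parabolic rescaling) onto a NONZERO punctured Leray profile. Typed for the disprover seat. -/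
def FrozenProfileLiouville : Prop :=
  ∀ (u : ℝ → ℝ³ → ℝ³) (p : ℝ → ℝ³ → ℝ) (V : ℝ³ → ℝ³) (Q : ℝ³ → ℝ),
    ContDiffOn ℝ (⊤ : ℕ∞) V {0}ᶜ → ContDiffOn ℝ (⊤ : ℕ∞) Q {0}ᶜ →
    (∀ y : ℝ³, y ≠ 0 → -((1 : ℝ) • Laplacian.laplacian V y) + (1 / 2 : ℝ) • V y +
        (1 / 2 : ℝ) • fderiv ℝ V y y + convect V V y + gradient Q y = 0) →
    (∀ y : ℝ³, y ≠ 0 → VectorCalculus.divergence V y = 0) →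
    IsClassicalNSSolutionOn (Set.Ioo (-1) 0) 1 0 u p →
    (∃ C : NNReal, ∀ t ∈ Set.Ioo (-1 : ℝ) 0, ∫⁻ x in Metric.ball (0 : ℝ³) 1, ‖u t x‖ₑ ^ 2 ≤ C) →
    (∫⁻ t in Set.Ioo (-1 : ℝ) 0, ∫⁻ x in Metric.ball (0 : ℝ³) 1,
        ENNReal.ofReal (frobeniusNormSq (fderiv ℝ (u t) x)) < ⊤) →
    (∀ y : ℝ³, y ≠ 0 → Filter.Tendsto (fun t : ℝ => Real.sqrt (0 - t) • u t (Real.sqrt (0 - t) • y))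
      (nhdsWithin 0 (Set.Iio 0)) (nhds (V y))) →
    ∀ y : ℝ³, y ≠ 0 → V y = 0

/-- The Liouville target refutes the homogeneous special case: it implies ¬`LandauTailLocal`
(a Landau-tailed local singularity freezes onto the punctured Leray profile U itself, since a steady
(−1)-homogeneous U solves the rate-1/2 profile system off 0 by Euler's relation). -/
theorem not_landauTailLocal_of_frozenProfileLiouville (h : FrozenProfileLiouville) : ¬ LandauTailLocal := by
  rintro ⟨u, p, U, P, ⟨hU, hP, hNS, hdiv, hhom, ⟨x₀, hx₀⟩⟩, hcl, hE, hD, hconv⟩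
  have hprof : ∀ y : ℝ³, y ≠ 0 → -((1 : ℝ) • Laplacian.laplacian U y) + (1 / 2 : ℝ) • U y +
      (1 / 2 : ℝ) • fderiv ℝ U y y + convect U U y + gradient P y = 0 := by
    intro y hy
    have hdiff : DifferentiableAt ℝ U y :=
      (hU.differentiableOn (by simp)).differentiableAt (isOpen_compl_singleton.mem_nhds hy)
    have hEul : fderiv ℝ U y y = (-1 : ℝ) • U y :=
      fderiv_apply_self_of_inv_smul hy (fun c hc => hhom c hc y) hdiff
    have h1 := hNS y hy
    rw [hEul]
    have key : (1 / 2 : ℝ) • U y + (1 / 2 : ℝ) • ((-1 : ℝ) • U y) = 0 := by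
      rw [smul_smul, ← add_smul]; norm_num
    calc -((1 : ℝ) • Laplacian.laplacian U y) + (1 / 2 : ℝ) • U y + (1 / 2 : ℝ) • ((-1 : ℝ) • U y) +
          convect U U y + gradient P y
        = ((1 / 2 : ℝ) • U y + (1 / 2 : ℝ) • ((-1 : ℝ) • U y)) + (convect U U y + gradient P y) -
            (1 : ℝ) • Laplacian.laplacian U y := by abel
      _ = 0 := by rw [key, h1]; simp
  have hzero := h u p U P hU hP hprof hdiv hcl hE hD hconv
  by_cases hx : x₀ = 0
  · subst hx
    -- homogeneity forces U 0 = 0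
    have h2 := hhom 2 (by norm_num) 0
    rw [smul_zero] at h2
    -- U 0 = 2⁻¹ • U 0 ⇒ U 0 = 0
    have : U 0 = 0 := by
      have h3 : (1 - (2 : ℝ)⁻¹) • U 0 = 0 := by rw [sub_smul, one_smul, ← h2, sub_self]
      rcases smul_eq_zero.mp h3 with h4 | h4
      · norm_num at h4
      · exact h4
    exact hx₀ this
  · exact hx₀ (hzero x₀ hx)

end Summit.NavierStokesRegularity.NavierStokesRegularity.Cruxes.LandauTailBlowup.Strategist
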